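import Summits.ABC.IUTFork.Thm311Checks
import Summits.ABC.IUTFork.Cor312EdgeAggregate
import HarnessLib

/-!
# Fork skeleton SCHEMA rows F-2220 / F-2221 / F-2282 / F-2775 — ∀-closures REFUTED, instances INHABITED

PROOF-ONLY companion (0 `def`, 0 `instance`, 0 notation; junk variants built inside the theorem terms) of the abc-iut cell,
block F (seat abc-iut-f-130, gen 7; director-abc g4 ROW SUPPLY `ROWS-LF-0348.tsv` «decide the label»), sequel to
`ForkSkeletonSchemaClosures{,B,C}.lean` (p495057, p495753, p496202). It imports — never edits — abc-iut-c312-1's signature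
files `Thm311LogKummer` (`Thm311.Column.KummerA`), `Thm311Multirad` (`Thm311.DegreesViaLogvol`), `Thm311Pilot`
(`Thm311.PilotNouns.AbsLogQPos`, `Thm311.PilotNouns.QCongruentSubHullAgg` via `Cor312EdgeAggregate`'s namespace — see below)
and c312-1's own non-tautology toy of record `Thm311Checks` (`toyIndex`, `toyShells`, `toyData`, `toyColumn`, `toyDegrees`,
`toyFull`; all log-volumes `0`, everything admissible).

Each row is a PARAMETRISED `Prop` over the FREE c312-1 signature (`LogShells`/`MRData`/`Column`/`GlobalDegrees`/`PilotNouns`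
are data-only structures); per row this file records the two CLOSED statements the kernel can make: `not_forall_<decl>`
(universal closure FALSE at junk data — SCHEMA-REFUTED) and `exists_<decl>` (INHABITED).

* F-2220 `Column.KummerA` — refuted by the column with Frobenius-like log-volume `≡ 1` against `toyData` (log-volume `≡ 0`);
  inhabited by `toyColumn`, `toyData`.
* F-2221 `DegreesViaLogvol` — refuted by global degrees `≡ 1` against log-volume `≡ 0`; inhabited by `toyDegrees`.
* F-2282 `PilotNouns.AbsLogQPos` (no kernel theorem concluded in this decl before) — refuted at `toyFull` (every log-volume is
  `0`, so `−|log(q)| = 0 ≮ 0`) with a junk `PilotNouns`; inhabited at the variant situation with log-volume `≡ −1`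
  (`−|log(q)| = −#F_l^⋇/l⋇ < 0`).
* F-2775 `PilotNouns.QCongruentSubHullAgg` — inhabited at `toyFull` (`R := ∅`); refuted at the variant with log-volume
  `A ↦ −𝟙[A nonempty]`, Θ-regions `∅` and identity hull (the hull of the union of the possible images is `∅`, forcing
  `R = ∅` and aggregate `0`, whereas `−|log(q)| < 0` for `qRegion := univ`).

HONEST FRAMING: a refuted ∀-closure says only that the SCHEMA over the free signature is not a theorem at junk data; the toy
is c312-1's non-tautology witness, NOT a model of initial Θ-data; nothing here bears on [IUTchIII] Thm. 3.11 / Cor. 3.12 or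
[IUTchIV], and no side is taken on any author. A FACT row is an assumption label on OUR typed statement; typed ≠ proved.
[claim: Mochizuki2012, status: disputed]
-/

noncomputable section

namespace Summit.ABC

namespace IUTFork

namespace SchemaClosures

open Thm311

/-- `F_l^⋇` of the toy index is a finite nonempty type (used to evaluate procession-normalized sums). [folklore] -/
private theorem toy_labelStar_card_pos : ∀ [Fintype toyIndex.LabelStar], 0 < Fintype.card toyIndex.LabelStar := by
  intro _
  exact Fintype.card_pos_iff.mpr ⟨⟨1, by decide⟩⟩

/-- At a situation over the toy index whose line-`n` log-volume is the CONSTANT `c`, the procession-normalized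
`q`-log-volume of ANY pilot nouns is `(1/l⋇) · #F_l^⋇ · c` (`#𝕍_ℚ = 1` in the toy). [folklore] -/
private theorem negLogQ_of_const {S : LatticeSituation toyIndex} (P : PilotNouns S) (n m : ℤ) (c : ℝ)
    (hc : ∀ (j : toyIndex.LabelStar) (vQ : toyIndex.VQ), (S.D n).logvol j.1 vQ (P.qRegion n m j vQ) = c) :
    ∃ k : ℕ, 0 < k ∧ P.negLogQ n m = (1 / (toyIndex.lstar : ℝ)) * (k * c) := by
  haveI : Fintype toyIndex.LabelStar := Fintype.ofFinite _
  letI : Fintype toyIndex.VQ := inferInstanceAs (Fintype Unit)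
  have hV : Fintype.card toyIndex.VQ = 1 := Fintype.card_eq_one_iff.mpr ⟨(), fun _ => rfl⟩
  refine ⟨Fintype.card toyIndex.LabelStar, toy_labelStar_card_pos, ?_⟩
  unfold PilotNouns.negLogQ
  congr 1
  have h1 : ∀ j : toyIndex.LabelStar,
      ∑ᶠ (vQ : toyIndex.VQ), (S.D n).logvol j.1 vQ (P.qRegion n m j vQ) = c := by
    intro j
    rw [finsum_eq_sum_of_fintype]
    simp_rw [hc]
    rw [Finset.sum_const, Finset.card_univ, nsmul_eq_mul, hV]
    simp
  simp_rw [h1]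
  rw [finsum_eq_sum_of_fintype, Finset.sum_const, Finset.card_univ, nsmul_eq_mul]

/-! ## F-2220 `Thm311.Column.KummerA` ([IUTchIII] Thm 3.11 (ii)(a): Kummer isomorphisms compatible with log-volumes) -/

/-- **F-2220, ∀-closure REFUTED**: the column whose Frobenius-like log-volume is `≡ 1` is not Kummer-compatible with
`toyData` (log-volume `≡ 0`) — at `m = 0`, `j = 0`, `A = ∅`. (Instance/conditional forms by name:
`kummerA_of_preservesRegions`, `kummerA_of_factorwiseRealisations`.) [claim: Mochizuki2012, status: disputed] -/
theorem not_forall_kummerA :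
    ¬ ∀ (T : ThetaIndex) (L : LogShells T) (C : Column L) (D : MRData L), C.KummerA D := by
  intro h
  let C : Column toyShells := { toyColumn with frobLogvol := fun _ _ _ _ => 1 }
  have h1 := (h toyIndex toyShells C toyData 0 0 () ∅ trivial).2
  change (1 : ℝ) = 0 at h1
  norm_num at h1

/-- **F-2220, INHABITED**: `toyColumn` is Kummer-compatible with `toyData` (both log-volumes `≡ 0`, everything admissible).
[claim: Mochizuki2012, status: disputed] -/
theorem exists_kummerA : ∃ (T : ThetaIndex) (L : LogShells T) (C : Column L) (D : MRData L), C.KummerA D :=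
  ⟨toyIndex, toyShells, toyColumn, toyData, fun _ _ _ _ _ => ⟨trivial, rfl⟩⟩

/-! ## F-2221 `Thm311.DegreesViaLogvol` ([IUTchIII] Thm 3.11 (i)(c), degree clause) -/

/-- **F-2221, ∀-closure REFUTED**: global degrees `≡ 1` are not computed by the log-volume `≡ 0` of `toyData`.
(Instance forms by name: `degreesViaLogvol_map`, `degreesViaLogvol_ofIdeals`.) [claim: Mochizuki2012, status: disputed] -/
theorem not_forall_degreesViaLogvol :
    ¬ ∀ (T : ThetaIndex) (L : LogShells T) (D : MRData L) (G : ∀ j : T.LabelStar, GlobalDegrees L j),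
        DegreesViaLogvol D G := by
  intro h
  let G : ∀ j : toyIndex.LabelStar, GlobalDegrees toyShells j := fun j => { toyDegrees j with deg := fun _ => 1 }
  have h1 := (h toyIndex toyShells toyData G ⟨1, by decide⟩ ()).2.2
  change (1 : ℝ) = ∑ᶠ (vQ : toyIndex.VQ), (0 : ℝ) at h1
  rw [finsum_zero] at h1
  norm_num at h1

/-- **F-2221, INHABITED**: `toyDegrees` (degree `0`, region everything) over `toyData`. [claim: Mochizuki2012, status: disputed] -/
theorem exists_degreesViaLogvol :
    ∃ (T : ThetaIndex) (L : LogShells T) (D : MRData L) (G : ∀ j : T.LabelStar, GlobalDegrees L j),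
        DegreesViaLogvol D G := by
  refine ⟨toyIndex, toyShells, toyData, toyDegrees, fun j J => ⟨fun _ => trivial, ?_, ?_⟩⟩
  · change {vQ : toyIndex.VQ | (0 : ℝ) ≠ 0}.Finite
    simp
  · change (0 : ℝ) = ∑ᶠ (vQ : toyIndex.VQ), (0 : ℝ)
    rw [finsum_zero]

/-! ## F-2282 `Thm311.PilotNouns.AbsLogQPos` ("`|log(q)| > 0`", [IUTchIII] Cor 3.12 p.174, in c312-1's nouns) -/

/-- **F-2282, ∀-closure REFUTED**: at c312-1's toy situation `toyFull` every log-volume is `0`, so for ANY pilot nouns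
`−|log(q)| = 0`, which is not `< 0`. [claim: Mochizuki2012, status: disputed] -/
theorem not_forall_pilotNouns_absLogQPos :
    ¬ ∀ (T : ThetaIndex) (S : LatticeSituation T) (P : PilotNouns S) (n m : ℤ), P.AbsLogQPos n m := by
  intro h
  let P : PilotNouns toyFull.toLatticeSituation :=
    { hull := fun _ _ _ => ClosureOperator.id _, thetaRegion := fun _ _ _ _ => ∅, thetaRegion3 := fun _ _ _ _ => ∅,
      thetaRegion_subset := fun _ _ _ _ => le_rfl, qRegion := fun _ _ _ _ => ∅ }
  obtain ⟨k, -, hk⟩ := negLogQ_of_const P 0 0 0 (fun _ _ => rfl)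
  have h1 := h toyIndex toyFull.toLatticeSituation P 0 0
  unfold PilotNouns.AbsLogQPos at h1
  rw [hk] at h1
  norm_num at h1

/-- **F-2282, INHABITED** (a kernel theorem concluding in this decl): at the variant of the toy whose log-volume is `≡ −1`,
every pilot nouns datum has `−|log(q)| = −#F_l^⋇/l⋇ < 0`. [claim: Mochizuki2012, status: disputed] -/
theorem exists_pilotNouns_absLogQPos :
    ∃ (T : ThetaIndex) (S : LatticeSituation T) (P : PilotNouns S) (n m : ℤ), P.AbsLogQPos n m := by
  let D : MRData toyShells := { toyData with logvol := fun _ _ _ => -1 }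
  let S : LatticeSituation toyIndex :=
    { L := toyShells, D := fun _ => D, G := fun _ j => toyDegrees j, col := fun _ => toyColumn }
  let P : PilotNouns S :=
    { hull := fun _ _ _ => ClosureOperator.id _, thetaRegion := fun _ _ _ _ => ∅, thetaRegion3 := fun _ _ _ _ => ∅,
      thetaRegion_subset := fun _ _ _ _ => le_rfl, qRegion := fun _ _ _ _ => ∅ }
  obtain ⟨k, hk, hq⟩ := negLogQ_of_const P 0 0 (-1) (fun _ _ => rfl)
  refine ⟨toyIndex, S, P, 0, 0, ?_⟩
  unfold PilotNouns.AbsLogQPos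
  rw [hq]
  have hk' : (0 : ℝ) < k := by exact_mod_cast hk
  have : (0 : ℝ) < 1 / (toyIndex.lstar : ℝ) := by simp [toyIndex]
  nlinarith

/-! ## F-2775 `Thm311.PilotNouns.QCongruentSubHullAgg` (Reading 4, aggregate form, in c312-1's nouns) -/

/-- **F-2775, INHABITED**: at `toyFull` (all log-volumes `0`) the empty regions are admissible sub-regions of the hulls with
aggregate log-volume `0 = −|log(q)|`. [claim: Mochizuki2012, status: disputed] -/
theorem exists_qCongruentSubHullAgg :
    ∃ (T : ThetaIndex) (S : LatticeSituation T) (P : PilotNouns S) (n m : ℤ), P.QCongruentSubHullAgg n m := by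
  let P : PilotNouns toyFull.toLatticeSituation :=
    { hull := fun _ _ _ => ClosureOperator.id _, thetaRegion := fun _ _ _ _ => ∅, thetaRegion3 := fun _ _ _ _ => ∅,
      thetaRegion_subset := fun _ _ _ _ => le_rfl, qRegion := fun _ _ _ _ => ∅ }
  obtain ⟨k, -, hq⟩ := negLogQ_of_const P 0 0 0 (fun _ _ => rfl)
  refine ⟨toyIndex, toyFull.toLatticeSituation, P, 0, 0, fun _ _ => ∅, fun _ _ => trivial, fun _ _ => Set.empty_subset _,
    ?_, ?_⟩
  · change {p : toyIndex.LabelStar × toyIndex.VQ | (0 : ℝ) ≠ 0}.Finite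
    simp
  · rw [hq]
    change (1 / (toyIndex.lstar : ℝ)) * ∑ᶠ (j : toyIndex.LabelStar) (vQ : toyIndex.VQ), (0 : ℝ) = _
    simp only [finsum_zero, mul_zero]

open Classical in
/-- **F-2775, ∀-closure REFUTED**: at the variant of the toy with log-volume `A ↦ −𝟙[A nonempty]`, pilot nouns with Θ-regions
`∅`, identity hull and `qRegion := univ`: the hull of the union of the possible images is `∅` (every indeterminacy image of
`∅` is `∅`), so a sub-region `R` of the hulls is `∅` everywhere and has aggregate `0`, whereas `−|log(q)| = −#F_l^⋇/l⋇ < 0`.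
(Conditional forms by name: `qCongruentSubHullAgg_of_cor312At_of_hullIVTAt`.) [claim: Mochizuki2012, status: disputed] -/
theorem not_forall_qCongruentSubHullAgg :
    ¬ ∀ (T : ThetaIndex) (S : LatticeSituation T) (P : PilotNouns S) (n m : ℤ), P.QCongruentSubHullAgg n m := by
  intro h
  let D : MRData toyShells := { toyData with logvol := fun _ _ A => if A.Nonempty then -1 else 0 }
  let S : LatticeSituation toyIndex :=
    { L := toyShells, D := fun _ => D, G := fun _ j => toyDegrees j, col := fun _ => toyColumn }
  let P : PilotNouns S :=
    { hull := fun _ _ _ => ClosureOperator.id _, thetaRegion := fun _ _ _ _ => ∅, thetaRegion3 := fun _ _ _ _ => ∅,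
      thetaRegion_subset := fun _ _ _ _ => le_rfl, qRegion := fun _ _ _ _ => Set.univ }
  -- the hulls of the unions of the possible images are empty
  have hU : ∀ (j : toyIndex.LabelStar) (vQ : toyIndex.VQ), P.Uhol 0 0 j vQ = ∅ := by
    intro j vQ
    apply Set.eq_empty_of_subset_empty
    change ClosureOperator.id _ (⋃₀ P.possibleImages 0 0 j vQ) ⊆ ∅
    rw [ClosureOperator.id_apply]
    rintro x ⟨R, ⟨Φ, -, rfl⟩, hx⟩
    simp [P] at hx
  obtain ⟨R, -, hR, -, hsum⟩ := h toyIndex S P 0 0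
  have hR0 : ∀ (j : toyIndex.LabelStar) (vQ : toyIndex.VQ), R j vQ = ∅ := fun j vQ =>
    Set.eq_empty_of_subset_empty ((hR j vQ).trans (hU j vQ).le)
  -- left side: aggregate 0
  have hL : (1 / (toyIndex.lstar : ℝ)) * ∑ᶠ (j : toyIndex.LabelStar) (vQ : toyIndex.VQ),
      (S.D 0).logvol j.1 vQ (R j vQ) = 0 := by
    have : ∀ (j : toyIndex.LabelStar) (vQ : toyIndex.VQ), (S.D 0).logvol j.1 vQ (R j vQ) = 0 := by
      intro j vQ
      rw [hR0]
      change (if (∅ : Set (toyShells.Packet j.1 vQ)).Nonempty then (-1 : ℝ) else 0) = 0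
      simp
    simp_rw [this]
    simp only [finsum_zero, mul_zero]
  -- right side: −|log(q)| < 0 (qRegion = univ is nonempty, log-volume −1)
  have hq : ∀ (j : toyIndex.Label) (vQ : toyIndex.VQ),
      (S.D 0).logvol j vQ (Set.univ : Set (S.L.Packet j vQ)) = -1 := by
    intro j vQ
    change (if (Set.univ : Set (toyShells.Packet j vQ)).Nonempty then (-1 : ℝ) else 0) = -1
    rw [if_pos Set.univ_nonempty]
  have hRHS : P.negLogQ 0 0 < 0 := by
    obtain ⟨k, hk, hqv⟩ := negLogQ_of_const P 0 0 (-1) (fun j vQ => hq j.1 vQ)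
    rw [hqv]
    have hk' : (0 : ℝ) < k := by exact_mod_cast hk
    have : (0 : ℝ) < 1 / (toyIndex.lstar : ℝ) := by simp [toyIndex]
    nlinarith
  rw [hL] at hsum
  exact hRHS.ne' hsum

end SchemaClosures

end IUTFork

end Summit.ABC

end
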